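import Mathlib
import Literature.Claims.NS.Chae2005
import HarnessLib

/-!
# Solo salvage for claim C78 `Chae2005` (cell `ns-claims`, D-0090): the TRUE abstract-grain steps, kernel-discharged

Claim: D. Chae, arXiv:math/0504219v1 (withdrawn v2), Thm 1.1 p. 3 (conditional finite-time enstrophy blow-up for
(NS)_ν, ν ≥ 0, in the data class (1.5)–(1.6)). ADJUDICATED #33 (lead g2 2026-08-26T23:58:23Z): NS conjunct first
failing step `Literature.Claims.NS.Chae2005.Step_6` = last «≥» of (2.11) p. 6, Euler conjunct `Step_9` = display after
(2.13) p. 7, both false lemma (countermodel) by `…Theorems.Chae2005.not_Step_6` / `not_Step_9` (p472016, refuter-6);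
`Step_7` also false (`not_Step_7`). This SALVAGE file (seat `ns-claims-salvage-p4` g2, solo lane, no item) records in the
kernel which of the typed ABSTRACT-GRAIN steps are TRUE, for the per-step table of the MAP row (as
`SoloSalvageChae2007.lean` does for the same author's C17):

* `step11_equiv_holds : Step_11_equiv` — p. 8 «the conditions (1.5)-(1.6) are equivalent to `σ₀ − νδ₀² − h₀ > 0`»:
  `(0 < a ∧ g < a²) ↔ 0 < a − √(g₊)`. TRUE (arithmetic).
* `step11_holds : Step_11` — (2.16)–(2.17) pp. 7–8: from (2.15) for `Ψ = 1/‖ω‖` and the «obvious estimates», the Riccati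
  lower bound `‖ω(t)‖ ≥ ‖ω₀‖/(1 − [σ₀ − νδ₀² − h₀]t)`. TRUE (arithmetic).
* `step8_holds : Step_8` — p. 6–7, (2.12) ⇒ Prop 2.1 (2.6)–(2.7) ⇒ (2.13): the `Ψ = 1/y` computation with right
  derivatives, `Ψ″ ≤ (3σ² − G)Ψ` and `Ψ″ − (√((3σ² − G)₊))²Ψ ≤ 0`. TRUE (calculus + arithmetic). This step sits BEFORE
  the Euler-conjunct locator `Step_9`.
* `step10_holds : Step_10` (appended, part 2) — p. 7–8, (2.14) ⇒ (2.15) and the «obvious estimates»: integrating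
  `F″ − 2hF′ ≤ 0` for `F = Ψe^{∫h}` with RIGHT derivatives only (Mathlib's one-sided fence
  `image_le_of_deriv_right_le_deriv_boundary`, FTC from the right for `∫₀ᵗ h` with `h` continuous on `[0,T)`),
  `e^{∫h} ≥ 1`, `∫₀ᵗ e^{2∫h} ≥ t`. TRUE (calculus).

Nothing here asserts a disputed step: the three statements are the typed Props of `Literature.Claims.NS.Chae2005`
(p469179 + rev 2 p472381) proved outright. The solution-grain steps 1/2/3/12 are classical with tree counterparts
(`MajdaBertozzi2002_localExistenceH3_holds`, `hasSobolevExtensionPast_of_uniform_H1_bound`, …; see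
`claims/Chae2005/SALVAGE.md` §1) and are not restated.

WHAT THIS IS NOT: not a claim about NS regularity or blow-up; not a claim about any author beyond the typed locator.
-/

set_option linter.dupNamespace false

namespace Summit.NavierStokesRegularity.NavierStokesRegularity.Theorems.Chae2005

open Set

/-- **Step 11 (equivalence), p. 8, is TRUE**: «(1.5)-(1.6) are equivalent to `σ₀ − νδ₀² − h₀ > 0`», `h₀ = √(g(0)₊)`:
`(0 < a ∧ g < a²) ↔ 0 < a − √(max g 0)`. Arithmetic (`Real.sqrt_lt'`, `Real.lt_sqrt`).
[cite: Chae2005FiniteTimeSingularitiesWithdrawn, (2.16)–(2.17) p. 8] -/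
theorem step11_equiv_holds : Literature.Claims.NS.Chae2005.Step_11_equiv := by
  intro a g
  constructor
  · rintro ⟨ha, hg⟩
    have : Real.sqrt (max g 0) < a := by
      rw [Real.sqrt_lt' ha]
      exact max_lt hg (by positivity)
    linarith
  · intro h
    have hs : Real.sqrt (max g 0) < a := by linarith
    have h0 : 0 ≤ Real.sqrt (max g 0) := Real.sqrt_nonneg _
    have ha : 0 < a := lt_of_le_of_lt h0 hs
    refine ⟨ha, ?_⟩
    have := (Real.sqrt_lt' ha).1 hs
    exact lt_of_le_of_lt (le_max_left g 0) this

/-- **Step 11, (2.16)–(2.17) pp. 7–8, is TRUE** at the typed arithmetic grain: with `y0 = ‖ω₀‖ > 0`, `yt = ‖ω(t)‖ > 0`,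
`κ = a − √(g₊) > 0`, `κt < 1`, `t ≤ I`, `Ht ≥ 0` and (2.15) in the form
`yt⁻¹ ≤ (y0⁻¹ + (√(g₊)·y0⁻¹ − a·y0/y0²)·I)·e^{−Ht}`, one gets `y0/(1 − κt) ≤ yt`. (The coefficient is `−κ/y0`; if
`1 − κI ≤ 0` the hypothesis contradicts `yt > 0`, else `yt⁻¹ ≤ (1 − κI)/y0 ≤ (1 − κt)/y0`.)
[cite: Chae2005FiniteTimeSingularitiesWithdrawn, (2.16)–(2.17) pp. 7–8] -/
theorem step11_holds : Literature.Claims.NS.Chae2005.Step_11 := by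
  intro y0 yt a g I Ht t hy0 hyt ht htI hHt hκ hκt h215
  set κ : ℝ := a - Real.sqrt (max g 0) with hκdef
  -- rewrite the coefficient of `I`
  have hcoef : Real.sqrt (max g 0) * y0⁻¹ + -(a * y0) / y0 ^ 2 = -κ / y0 := by
    rw [hκdef]
    field_simp
    ring
  rw [hcoef] at h215
  have hexp : Real.exp (-Ht) ≤ 1 := by
    rw [Real.exp_le_one_iff]; linarith
  have hexp0 : 0 < Real.exp (-Ht) := Real.exp_pos _
  have h1κt : 0 < 1 - κ * t := by linarith
  -- the bracket `(y0⁻¹ + (-κ / y0) * I) = (1 - κ I)/y0`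
  have hbr : y0⁻¹ + -κ / y0 * I = (1 - κ * I) / y0 := by
    field_simp
    ring
  rw [hbr] at h215
  by_cases hI : 1 - κ * I ≤ 0
  · -- contradiction with yt > 0
    exfalso
    have hnonpos : (1 - κ * I) / y0 * Real.exp (-Ht) ≤ 0 :=
      mul_nonpos_of_nonpos_of_nonneg (div_nonpos_of_nonpos_of_nonneg hI hy0.le) hexp0.le
    have : (0 : ℝ) < yt⁻¹ := inv_pos.mpr hyt
    linarith
  · push Not at hI
    have hA : (1 - κ * I) / y0 * Real.exp (-Ht) ≤ (1 - κ * I) / y0 := by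
      have hnn : 0 ≤ (1 - κ * I) / y0 := div_nonneg hI.le hy0.le
      calc (1 - κ * I) / y0 * Real.exp (-Ht) ≤ (1 - κ * I) / y0 * 1 :=
            mul_le_mul_of_nonneg_left hexp hnn
        _ = (1 - κ * I) / y0 := mul_one _
    have hB : (1 - κ * I) / y0 ≤ (1 - κ * t) / y0 := by
      apply div_le_div_of_nonneg_right _ hy0.le
      have : κ * t ≤ κ * I := mul_le_mul_of_nonneg_left htI hκ.le
      linarith
    have hC : yt⁻¹ ≤ (1 - κ * t) / y0 := h215.trans (hA.trans hB)
    -- invert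
    have hpos : 0 < (1 - κ * t) / y0 := div_pos h1κt hy0
    have := inv_anti₀ (inv_pos.mpr hyt) hC
    -- `this : ((1 - κ t)/y0)⁻¹ ≤ (yt⁻¹)⁻¹`
    rwa [inv_inv, inv_div] at this

/-- **Step 8, pp. 6–7 ((2.12) ⇒ Prop 2.1 (2.6)–(2.7) ⇒ (2.13)), is TRUE** at the typed abstract grain: for `y > 0` with right
derivatives `y′ = y1`, `y1′ = y2` on `[0,T)`, `G y² ≤ y2·y + y1²` and `y1² ≤ σ² y²`, the function `Ψ = 1/y` has right
derivatives `Ψ1 = −y1/y²`, `Ψ2 = −y2/y² + 2y1²/y³` with `Ψ2 ≤ (3σ² − G)Ψ` and `Ψ2 − (√((3σ² − G)₊))²Ψ ≤ 0`.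
Calculus (`HasDerivWithinAt.inv`, `.div`, `.pow`) + arithmetic. [cite: Chae2005FiniteTimeSingularitiesWithdrawn, (2.12)–(2.13) pp. 6–7] -/
theorem step8_holds : Literature.Claims.NS.Chae2005.Step_8 := by
  intro T y y1 y2 G σf hT hyp
  refine ⟨fun t => -y1 t / y t ^ 2, fun t => -y2 t / y t ^ 2 + 2 * y1 t ^ 2 / y t ^ 3, ?_⟩
  intro t ht
  obtain ⟨hy, hdy, hdy1, hG, hσ⟩ := hyp t ht
  have hy0 : y t ≠ 0 := hy.ne'
  have hy2 : y t ^ 2 ≠ 0 := pow_ne_zero 2 hy0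
  have hy3 : 0 < y t ^ 3 := pow_pos hy 3
  -- the key inequality `Ψ2 ≤ (3σ² − G)/y`
  have hΨ2 : -y2 t / y t ^ 2 + 2 * y1 t ^ 2 / y t ^ 3 ≤ (3 * σf t ^ 2 - G t) * (y t)⁻¹ := by
    have e1 : -y2 t / y t ^ 2 + 2 * y1 t ^ 2 / y t ^ 3 = (-y2 t * y t + 2 * y1 t ^ 2) / y t ^ 3 := by
      field_simp
    have e2 : (3 * σf t ^ 2 - G t) * (y t)⁻¹ = ((3 * σf t ^ 2 - G t) * y t ^ 2) / y t ^ 3 := by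
      field_simp
    rw [e1, e2]
    exact div_le_div_of_nonneg_right (by nlinarith [hG, hσ]) hy3.le
  refine ⟨?_, ?_, rfl, hΨ2, ?_⟩
  · -- derivative of 1/y
    exact hdy.inv hy0
  · -- derivative of Ψ1 = -y1 / y^2
    have hnum : HasDerivWithinAt (fun s => -y1 s) (-y2 t) (Ici t) t := hdy1.neg
    have hden : HasDerivWithinAt (fun s => y s ^ 2) (↑(2:ℕ) * y t ^ (2 - 1) * y1 t) (Ici t) t := hdy.pow 2
    have hq := hnum.div hden hy2
    have heq : (-y2 t * y t ^ 2 - -y1 t * (↑(2:ℕ) * y t ^ (2 - 1) * y1 t)) / (y t ^ 2) ^ 2 =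
        -y2 t / y t ^ 2 + 2 * y1 t ^ 2 / y t ^ 3 := by
      push_cast
      field_simp
      ring
    rw [heq] at hq
    exact hq
  · -- Ψ2 − (√(X₊))² Ψ ≤ 0
    have hX : Real.sqrt (max (3 * σf t ^ 2 - G t) 0) ^ 2 = max (3 * σf t ^ 2 - G t) 0 :=
      Real.sq_sqrt (le_max_right _ _)
    have hmax : (3 * σf t ^ 2 - G t) * (y t)⁻¹ ≤ max (3 * σf t ^ 2 - G t) 0 * (y t)⁻¹ :=
      mul_le_mul_of_nonneg_right (le_max_left _ _) (inv_pos.mpr hy).le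
    show -y2 t / y t ^ 2 + 2 * y1 t ^ 2 / y t ^ 3 - Real.sqrt (max (3 * σf t ^ 2 - G t) 0) ^ 2 * (y t)⁻¹ ≤ 0
    rw [hX]
    linarith

/-! ## Part 2 — Step 10 ((2.14) ⇒ (2.15), p. 7–8) -/

open MeasureTheory Filter Topology

/-- FTC from the right on `[0,T)`: for `g` continuous on `Ico 0 T`, the primitive `s ↦ ∫₀ˢ g` has right
derivative `g t` at every `t ∈ [0,T)` (Mathlib's `intervalIntegral.integral_hasDerivWithinAt_right` with the
`𝓝[≥] t` / `𝓝[>] t` filter pair). [folklore] -/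
private theorem hasDerivWithinAt_primitive_Ici {g : ℝ → ℝ} {T : ℝ} (hg : ContinuousOn g (Ico 0 T))
    {t : ℝ} (ht : t ∈ Ico 0 T) :
    HasDerivWithinAt (fun s => ∫ τ in (0:ℝ)..s, g τ) (g t) (Ici t) t := by
  have hsub : uIcc (0:ℝ) t ⊆ Ico 0 T := by
    rw [uIcc_of_le ht.1]; exact fun r hr => ⟨hr.1, hr.2.trans_lt ht.2⟩
  have hint : IntervalIntegrable g volume 0 t := (hg.mono hsub).intervalIntegrable
  have hmem : Ico 0 T ∈ 𝓝[>] t :=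
    mem_of_superset (Ioo_mem_nhdsGT ht.2) fun r hr => ⟨ht.1.trans hr.1.le, hr.2⟩
  have hle : 𝓝[>] t ≤ 𝓝[Ico 0 T] t := nhdsWithin_le_iff.2 hmem
  have hmeas : StronglyMeasurableAtFilter g (𝓝[>] t) volume :=
    (hg.stronglyMeasurableAtFilter_nhdsWithin measurableSet_Ico t).filter_mono hle
  have hcont : ContinuousWithinAt g (Ioi t) t := (hg t ht).mono_of_mem_nhdsWithin hmem
  exact intervalIntegral.integral_hasDerivWithinAt_right hint hmeas hcont

/-- The primitive of a function continuous on `Ico 0 T` is continuous on every `Icc 0 t`, `t < T`. [folklore] -/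
private theorem continuousOn_primitive_Icc {g : ℝ → ℝ} {T : ℝ} (hg : ContinuousOn g (Ico 0 T))
    {t : ℝ} (ht : t ∈ Ico 0 T) :
    ContinuousOn (fun s => ∫ τ in (0:ℝ)..s, g τ) (Icc 0 t) := by
  have hsub : Icc (0:ℝ) t ⊆ Ico 0 T := fun r hr => ⟨hr.1, hr.2.trans_lt ht.2⟩
  have hint : IntegrableOn g (uIcc 0 t) volume := by
    rw [uIcc_of_le ht.1]; exact (hg.mono hsub).integrableOn_Icc
  have h := intervalIntegral.continuousOn_primitive_interval hint
  rw [uIcc_of_le ht.1] at h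
  exact h

/-- **Step 10, (2.14) ⇒ (2.15) and the «obvious estimates», p. 7–8, is TRUE** at the typed abstract grain: with
`H = ∫₀ᵗ h` (`h ≥ 0` continuous on `[0,T)`), `F = Ψe^{H}` having right derivative `F1` and `F1` right derivative
`F2` with `F2 − 2hF1 ≤ 0`, one gets (2.15) `Ψ(t) ≤ [Ψ₀ + (h₀Ψ₀ + Ψ₀′)∫₀ᵗ e^{2H}] e^{−H(t)}`, `H(t) ≥ 0` and
`∫₀ᵗ e^{2H} ≥ t`. Proof: `F1·e^{−2H}` has right derivative `(F2 − 2hF1)e^{−2H} ≤ 0`, so `F1 ≤ F1(0)e^{2H}`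
(one-sided fence); a second fence integrates `F′ = F1 ≤ F1(0)e^{2H}`. (The step is AFTER the locators
`Step_6`/`Step_9`; it is the honest integrating-factor calculus the print invokes.)
[cite: Chae2005FiniteTimeSingularitiesWithdrawn, (2.14)–(2.15) p. 7–8] -/
theorem step10_holds : Literature.Claims.NS.Chae2005.Step_10 := by
  intro T Ψ F1 F2 h Ψ1₀ hT hh hh0 hΨ hF1 hF10 hyp t ht
  -- the primitive `H = ∫₀ h` and its right derivative
  set H : ℝ → ℝ := fun s => ∫ τ in (0:ℝ)..s, h τ with hHdef
  have hHder : ∀ s ∈ Ico (0:ℝ) T, HasDerivWithinAt H (h s) (Ici s) s := fun s hs =>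
    hasDerivWithinAt_primitive_Ici hh hs
  have hH0 : H 0 = 0 := by simp [hHdef]
  have hHnn : ∀ s ∈ Ico (0:ℝ) T, 0 ≤ H s := fun s hs =>
    intervalIntegral.integral_nonneg hs.1 fun u hu => hh0 u ⟨hu.1, hu.2.trans_lt hs.2⟩
  -- an intermediate time `t < t₁ < T`, so that everything is continuous on `[0, t₁] ⊇ [0, t]`
  set t₁ : ℝ := (t + T) / 2 with ht₁def
  have ht₁ : t₁ ∈ Ico (0:ℝ) T := ⟨by rw [ht₁def]; linarith [ht.1, ht.2], by rw [ht₁def]; linarith [ht.2]⟩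
  have htt₁ : t < t₁ := by rw [ht₁def]; linarith [ht.2]
  have hHcont₁ : ContinuousOn H (Icc 0 t₁) := continuousOn_primitive_Icc hh ht₁
  have hHcontIco : ContinuousOn H (Ico 0 t₁) := hHcont₁.mono Ico_subset_Icc_self
  -- Step A: `F1 s · e^{−2H(s)} ≤ F1 0` on `[0, t₁)`
  have hA : ∀ s ∈ Ico (0:ℝ) t₁, F1 s * Real.exp (-2 * H s) ≤ F1 0 := by
    intro s hs
    have hsT : Icc (0:ℝ) s ⊆ Ico 0 T := fun r hr => ⟨hr.1, (hr.2.trans_lt hs.2).trans ht₁.2⟩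
    have hGcont : ContinuousOn (fun r => F1 r * Real.exp (-2 * H r)) (Icc 0 s) :=
      (hF1.mono hsT).mul ((Real.continuous_exp.comp_continuousOn
        (((hHcont₁.mono (Icc_subset_Icc_right hs.2.le))).const_smul (-2 : ℝ))).congr fun r _ => by
          simp [smul_eq_mul])
    have hGder : ∀ r ∈ Ico (0:ℝ) s, HasDerivWithinAt (fun r => F1 r * Real.exp (-2 * H r))
        (F2 r * Real.exp (-2 * H r) + F1 r * (Real.exp (-2 * H r) * (-2 * h r))) (Ici r) r := by
      intro r hr
      have hrT : r ∈ Ico (0:ℝ) T := ⟨hr.1, (hr.2.trans hs.2).trans ht₁.2⟩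
      have h1 : HasDerivWithinAt (fun r => -2 * H r) (-2 * h r) (Ici r) r := (hHder r hrT).const_mul (-2)
      exact (hyp r hrT).2.1.mul h1.exp
    have hbound : ∀ r ∈ Ico (0:ℝ) s,
        F2 r * Real.exp (-2 * H r) + F1 r * (Real.exp (-2 * H r) * (-2 * h r)) ≤ 0 := by
      intro r hr
      have hrT : r ∈ Ico (0:ℝ) T := ⟨hr.1, (hr.2.trans hs.2).trans ht₁.2⟩
      have hineq : F2 r - 2 * h r * F1 r ≤ 0 := (hyp r hrT).2.2
      have hpos : 0 < Real.exp (-2 * H r) := Real.exp_pos _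
      have : F2 r * Real.exp (-2 * H r) + F1 r * (Real.exp (-2 * H r) * (-2 * h r)) =
          (F2 r - 2 * h r * F1 r) * Real.exp (-2 * H r) := by ring
      rw [this]
      exact mul_nonpos_of_nonpos_of_nonneg hineq hpos.le
    have h0 : F1 0 * Real.exp (-2 * H 0) ≤ F1 0 := by rw [hH0, mul_zero, Real.exp_zero, mul_one]
    exact image_le_of_deriv_right_le_deriv_boundary (B := fun _ => F1 0) (B' := fun _ => 0) hGcont hGder h0
      continuousOn_const (fun r _ => hasDerivWithinAt_const r (Ici r) (F1 0)) hbound (right_mem_Icc.2 hs.1)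
  -- consequence: `F1 s ≤ F1(0) e^{2H(s)}`
  have hA' : ∀ s ∈ Ico (0:ℝ) t₁, F1 s ≤ F1 0 * Real.exp (2 * H s) := by
    intro s hs
    have h := mul_le_mul_of_nonneg_right (hA s hs) (Real.exp_pos (2 * H s)).le
    have hexp : Real.exp (-2 * H s) * Real.exp (2 * H s) = 1 := by
      rw [← Real.exp_add]; simp
    calc F1 s = F1 s * (Real.exp (-2 * H s) * Real.exp (2 * H s)) := by rw [hexp, mul_one]
      _ = F1 s * Real.exp (-2 * H s) * Real.exp (2 * H s) := by ring
      _ ≤ F1 0 * Real.exp (2 * H s) := h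
  -- Step B: the second fence, for `F = Ψ e^{H}` against `Ψ 0 + F1(0) ∫₀ e^{2H}`
  set I : ℝ → ℝ := fun s => ∫ τ in (0:ℝ)..s, Real.exp (2 * H τ) with hIdef
  have hE2cont : ContinuousOn (fun τ => Real.exp (2 * H τ)) (Ico 0 t₁) :=
    Real.continuous_exp.comp_continuousOn ((hHcontIco.const_smul (2 : ℝ)).congr fun r _ => by
      simp [smul_eq_mul])
  have hIder : ∀ r ∈ Ico (0:ℝ) t₁, HasDerivWithinAt I (Real.exp (2 * H r)) (Ici r) r := fun r hr =>
    hasDerivWithinAt_primitive_Ici hE2cont hr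
  have hI0 : I 0 = 0 := by simp [hIdef]
  have htIco : t ∈ Ico (0:ℝ) t₁ := ⟨ht.1, htt₁⟩
  have hIcont : ContinuousOn I (Icc 0 t) := continuousOn_primitive_Icc hE2cont htIco
  have hsubt : Icc (0:ℝ) t ⊆ Ico 0 T := fun r hr => ⟨hr.1, hr.2.trans_lt ht.2⟩
  have hFcont : ContinuousOn (fun r => Ψ r * Real.exp (H r)) (Icc 0 t) :=
    (hΨ.mono hsubt).mul (Real.continuous_exp.comp_continuousOn (hHcont₁.mono (Icc_subset_Icc_right htt₁.le)))
  have hFder : ∀ r ∈ Ico (0:ℝ) t, HasDerivWithinAt (fun s => Ψ s * Real.exp (H s)) (F1 r) (Ici r) r :=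
    fun r hr => (hyp r ⟨hr.1, hr.2.trans ht.2⟩).1
  have hBcont : ContinuousOn (fun r => Ψ 0 + F1 0 * I r) (Icc 0 t) :=
    continuousOn_const.add (hIcont.const_smul (F1 0) |>.congr fun r _ => by simp [smul_eq_mul])
  have hBder : ∀ r ∈ Ico (0:ℝ) t,
      HasDerivWithinAt (fun r => Ψ 0 + F1 0 * I r) (F1 0 * Real.exp (2 * H r)) (Ici r) r := by
    intro r hr
    have := ((hIder r ⟨hr.1, hr.2.trans htt₁⟩).const_mul (F1 0)).const_add (Ψ 0)
    simpa using this
  have ha : Ψ 0 * Real.exp (H 0) ≤ Ψ 0 + F1 0 * I 0 := by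
    rw [hH0, hI0, Real.exp_zero, mul_one, mul_zero, add_zero]
  have hboundB : ∀ r ∈ Ico (0:ℝ) t, F1 r ≤ F1 0 * Real.exp (2 * H r) := fun r hr =>
    hA' r ⟨hr.1, hr.2.trans htt₁⟩
  have hΦ : Ψ t * Real.exp (H t) ≤ Ψ 0 + F1 0 * I t :=
    image_le_of_deriv_right_le_deriv_boundary hFcont hFder ha hBcont hBder hboundB (right_mem_Icc.2 ht.1)
  -- conclusions
  refine ⟨?_, hHnn t ht, ?_⟩
  · -- (2.15)
    have hpos : 0 < Real.exp (-H t) := Real.exp_pos _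
    have h1 : Ψ t = Ψ t * Real.exp (H t) * Real.exp (-H t) := by
      rw [mul_assoc, ← Real.exp_add]; simp
    rw [h1, hF10] at *
    have hc : Ψ1₀ + h 0 * Ψ 0 = h 0 * Ψ 0 + Ψ1₀ := add_comm _ _
    calc Ψ t * Real.exp (H t) * Real.exp (-H t) ≤ (Ψ 0 + (Ψ1₀ + h 0 * Ψ 0) * I t) * Real.exp (-H t) :=
          mul_le_mul_of_nonneg_right hΦ hpos.le
      _ = (Ψ 0 + (h 0 * Ψ 0 + Ψ1₀) * I t) * Real.exp (-H t) := by rw [hc]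
  · -- `t ≤ ∫₀ᵗ e^{2H}`
    have hone : ∀ τ ∈ Icc (0:ℝ) t, (1:ℝ) ≤ Real.exp (2 * H τ) := by
      intro τ hτ
      have := hHnn τ (hsubt hτ)
      exact Real.one_le_exp (by linarith)
    have hint1 : IntervalIntegrable (fun _ : ℝ => (1:ℝ)) volume 0 t := intervalIntegrable_const
    have hint2 : IntervalIntegrable (fun τ => Real.exp (2 * H τ)) volume 0 t :=
      (hE2cont.mono (by rw [uIcc_of_le ht.1]; exact fun r hr => ⟨hr.1, hr.2.trans_lt htt₁⟩)).intervalIntegrable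
    have hmono := intervalIntegral.integral_mono_on ht.1 hint1 hint2 hone
    simpa using hmono

end Summit.NavierStokesRegularity.NavierStokesRegularity.Theorems.Chae2005
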